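import Mathlib
import Summits.ResolutionOfSingularities.ResolutionOfSingularities.Theorems.RadicialJungCleanModelsBranchDescent
import HarnessLib

/-!
# Route `RadicialJung`, crux `CleanModels` (stmt-ResolutionOfSingularities-15917), line `Sketch` rev 35, stub 6 `stub_cleanProp44` (X44c),
# `τ = 1` residual, (B5″) branch descent: THE RESIDUE-FIELD FORM — `κ(𝔮)` IS `p`-CLOSED IN `κ(𝔓)` FOR A MINIMAL FORMAL BRANCH `𝔓`

Seat decomp-res-hand-2 g14 (structural hand).  The conceptual heart of ✓ `…BranchDescent.lean` in its natural currency: for a local G-ring `(R, 𝔪)` of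
characteristic `p` and a prime `𝔓` of `R^` MINIMAL over `𝔮 R^`, `𝔮 = 𝔓 ∩ R`, the residue field extension `κ(𝔮) → κ(𝔓)` creates no new `p`-th
roots: `κ(𝔮) ∩ κ(𝔓)^p = κ(𝔮)^p`.  (Minimality makes the closed fibre of `R_𝔮 → (R^)_𝔓` a field, so `κ(𝔓) = (R^)_𝔓 / 𝔮 (R^)_𝔓` is a local ring of
the geometrically regular formal fibre `κ(𝔮) ⊗_R R^`; ✓ `forall_pow_ne_localization_of_isGeometricallyRegular`.)  Minimality cannot be dropped:
residue fields at NON-minimal primes of a geometrically regular algebra may be purely inseparable over the base (e.g. `K[x]_{(x^p − a)}`, `a ∉ K^p`),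
which is why the births application goes through a minimal formal branch of the axis.

* `exists_pow_eq_of_pow_eq_residueField_comap_fiber` — the statement at a prime of the formal fibre ring (auxiliary form).
* `exists_pow_eq_of_pow_eq_residueField_of_mem_minimalPrimes` — **for ANY ring map `φ : κ(𝔮) → κ(𝔓)` compatible with `R`** (e.g. Mathlib's
  canonical one), `c^p = φ y` with `c ∈ κ(𝔓)` forces `y ∈ κ(𝔮)^p`.

Honest framing: OURS, folklore (Matsumura §32; EGA IV₂ 7.8.3); nothing here proves (B5″)'s dictionary, X44c, any case of `CleanModels`, or resolution of
singularities in characteristic `p`. [cite: Matsumura1987, §32 p. 256]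
-/

set_option linter.dupNamespace false -- mandated namespace of this single-conjunct summit

noncomputable section

open IsLocalRing TensorProduct
open Literature.AlgebraicGeometry.Resolution

namespace Summit.ResolutionOfSingularities.ResolutionOfSingularities.Theorems.RadicialJung.CleanModels

universe u

section ResidueField

variable {R : Type u} [CommRing R] [IsLocalRing R]

/-- **`κ(𝔮)` is `p`-closed in `κ(𝔓)`, auxiliary form** (the formal prime presented as `q ∩ R^` for a prime `q` of the formal fibre ring
`κ(𝔮) ⊗_R R^`).  [cite: Matsumura1987, §32 p. 256] -/
theorem exists_pow_eq_of_pow_eq_residueField_comap_fiber (hG : IsGRing R) (p : ℕ) [hp : Fact p.Prime] [CharP R p]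
    (𝔮 : Ideal R) [𝔮.IsPrime] (q : Ideal (𝔮.Fiber (AdicCompletion (maximalIdeal R) R))) [q.IsPrime]
    (𝔓 : Ideal (AdicCompletion (maximalIdeal R) R)) [𝔓.IsPrime]
    (h𝔓 : 𝔓 = q.comap (Algebra.TensorProduct.includeRight :
      AdicCompletion (maximalIdeal R) R →ₐ[R] 𝔮.Fiber (AdicCompletion (maximalIdeal R) R)))
    (hmin : 𝔓 ∈ (𝔮.map (algebraMap R (AdicCompletion (maximalIdeal R) R))).minimalPrimes)
    (φ : 𝔮.ResidueField →+* 𝔓.ResidueField) (hφ : φ.comp (algebraMap R 𝔮.ResidueField) = algebraMap R 𝔓.ResidueField)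
    {y : 𝔮.ResidueField} {c : 𝔓.ResidueField} (hc : c ^ p = φ y) : ∃ z : 𝔮.ResidueField, z ^ p = y := by
  subst h𝔓
  haveI : IsNoetherianRing R := hG.1
  set r : Ideal (AdicCompletion (maximalIdeal R) R) := q.comap (Algebra.TensorProduct.includeRight :
      AdicCompletion (maximalIdeal R) R →ₐ[R] 𝔮.Fiber (AdicCompletion (maximalIdeal R) R)) with hr
  have hru : r.under R = 𝔮 := under_comap_includeRight_fiber 𝔮 q
  -- the formal fibre is geometrically regular; the closed fibre `B ⧸ 𝔮 B` of `R_𝔮 → B = (R^)_𝔓` is a domain, `≃ L = F_q`, and `𝔮 B = 𝔪_B`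
  have hRH : IsRegularHom R (AdicCompletion (maximalIdeal R) R) := hG.isRegularHom_adicCompletion
  have hgeo : IsGeometricallyRegular 𝔮.ResidueField (𝔮.Fiber (AdicCompletion (maximalIdeal R) R)) := hRH.2 𝔮
  haveI : IsNoetherianRing (AdicCompletion (maximalIdeal R) R) := isNoetherianRing_adicCompletion_maximalIdeal R
  have hF : IsRegularRing ((r.under R).Fiber (AdicCompletion (maximalIdeal R) R)) := hRH.isRegularRing_fiber (r.under R)
  haveI := isRegularLocalRing_quotient_of_isRegularRing_fiber (A := R) (B := AdicCompletion (maximalIdeal R) R) r hF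
  haveI : IsDomain (Localization.AtPrime r ⧸ (r.under R).map (algebraMap R (Localization.AtPrime r))) :=
    isDomain_of_isRegularLocalRing _
  let e : Localization.AtPrime q ≃ₐ[R]
      Localization.AtPrime r ⧸ (𝔮.map (algebraMap R (AdicCompletion (maximalIdeal R) R))).map
        (algebraMap (AdicCompletion (maximalIdeal R) R) (Localization.AtPrime r)) :=
    Ideal.Fiber.algEquivAux₂ 𝔮 q
  have hI : (𝔮.map (algebraMap R (AdicCompletion (maximalIdeal R) R))).map
      (algebraMap (AdicCompletion (maximalIdeal R) R) (Localization.AtPrime r)) =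
      (r.under R).map (algebraMap R (Localization.AtPrime r)) := by
    rw [hru, Ideal.map_map, ← IsScalarTower.algebraMap_eq]
  have hmin' : r ∈ ((r.under R).map (algebraMap R (AdicCompletion (maximalIdeal R) R))).minimalPrimes := by
    rw [hru]; exact hmin
  have hmax : (r.under R).map (algebraMap R (Localization.AtPrime r)) = maximalIdeal (Localization.AtPrime r) :=
    map_under_eq_maximalIdeal_of_mem_minimalPrimes r hmin'
  -- `κ(𝔓) = B ⧸ 𝔪_B = B ⧸ 𝔮 B ≃ L`, as `R`-algebras
  let e₂ : (Localization.AtPrime r ⧸ (𝔮.map (algebraMap R (AdicCompletion (maximalIdeal R) R))).map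
      (algebraMap (AdicCompletion (maximalIdeal R) R) (Localization.AtPrime r))) ≃ₐ[R] r.ResidueField :=
    Ideal.quotientEquivAlgOfEq R (hI.trans hmax)
  let ψ : r.ResidueField →ₐ[R] Localization.AtPrime q := e.symm.toAlgHom.comp e₂.symm.toAlgHom
  -- `ψ ∘ φ = algebraMap K L`: both are ring maps `K = Frac(R/𝔮) → L` compatible with `R`
  have hθ : (ψ : r.ResidueField →+* Localization.AtPrime q).comp φ =
      algebraMap 𝔮.ResidueField (Localization.AtPrime q) := by
    apply IsLocalization.ringHom_ext (nonZeroDivisors (R ⧸ 𝔮))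
    apply Ideal.Quotient.ringHom_ext
    ext x
    simp only [RingHom.comp_apply]
    rw [← Ideal.Quotient.algebraMap_eq, ← IsScalarTower.algebraMap_apply R (R ⧸ 𝔮) 𝔮.ResidueField,
      ← IsScalarTower.algebraMap_apply R 𝔮.ResidueField (Localization.AtPrime q)]
    have h1 : φ (algebraMap R 𝔮.ResidueField x) = algebraMap R r.ResidueField x := RingHom.congr_fun hφ x
    rw [h1]
    exact ψ.commutes x
  -- transport `c^p = φ y` to `L` and apply §1 of `…BranchDescent.lean`
  haveI : CharP 𝔮.ResidueField p := (CharP.charP_iff_prime_eq_zero hp.out).2 (by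
    rw [← map_natCast (algebraMap R 𝔮.ResidueField), CharP.cast_eq_zero, map_zero])
  have h2 : (ψ c) ^ p = algebraMap 𝔮.ResidueField (Localization.AtPrime q) y := by
    rw [← map_pow, hc, ← hθ]
    rfl
  by_contra hne
  push Not at hne
  exact forall_pow_ne_localization_of_isGeometricallyRegular p hgeo q hne (ψ c) h2

/-- **`κ(𝔮)` is `p`-closed in `κ(𝔓)` for a minimal formal branch `𝔓`.**  `R` a local G-ring of characteristic `p`, `𝔓` a prime of the completion
`R^` minimal over `𝔮 R^`, `𝔮 = 𝔓 ∩ R`, and `φ : κ(𝔮) → κ(𝔓)` ANY ring map compatible with `R → R^` (e.g. the canonical one): if `y ∈ κ(𝔮)`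
becomes a `p`-th power in `κ(𝔓)` (`c^p = φ y`), then `y` is a `p`-th power in `κ(𝔮)`. [cite: Matsumura1987, §32 p. 256] -/
theorem exists_pow_eq_of_pow_eq_residueField_of_mem_minimalPrimes (hG : IsGRing R) (p : ℕ) [Fact p.Prime] [CharP R p]
    (𝔓 : Ideal (AdicCompletion (maximalIdeal R) R)) [𝔓.IsPrime]
    (hmin : 𝔓 ∈ ((𝔓.under R).map (algebraMap R (AdicCompletion (maximalIdeal R) R))).minimalPrimes)
    (φ : (𝔓.under R).ResidueField →+* 𝔓.ResidueField)
    (hφ : φ.comp (algebraMap R (𝔓.under R).ResidueField) = algebraMap R 𝔓.ResidueField)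
    {y : (𝔓.under R).ResidueField} {c : 𝔓.ResidueField} (hc : c ^ p = φ y) :
    ∃ z : (𝔓.under R).ResidueField, z ^ p = y := by
  let qq : PrimeSpectrum ((𝔓.under R).Fiber (AdicCompletion (maximalIdeal R) R)) :=
    PrimeSpectrum.primesOverOrderIsoFiber R (AdicCompletion (maximalIdeal R) R) (𝔓.under R) ⟨𝔓, inferInstance, inferInstance⟩
  have hq : qq.asIdeal.comap (Algebra.TensorProduct.includeRight :
      AdicCompletion (maximalIdeal R) R →ₐ[R] (𝔓.under R).Fiber (AdicCompletion (maximalIdeal R) R)) = 𝔓 := by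
    have h1 := PrimeSpectrum.coe_primesOverOrderIsoFiber_symm_apply (R := R) (S := AdicCompletion (maximalIdeal R) R)
      (𝔓.under R) qq
    rw [OrderIso.symm_apply_apply] at h1
    exact h1.symm
  exact exists_pow_eq_of_pow_eq_residueField_comap_fiber hG p (𝔓.under R) qq.asIdeal 𝔓 hq.symm hmin φ hφ hc

end ResidueField

end Summit.ResolutionOfSingularities.ResolutionOfSingularities.Theorems.RadicialJung.CleanModels

end
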